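import Summits.ResolutionOfSingularities.ResolutionOfSingularities.Theorems.HomologicalConductorNoZenoLipman12OfB
import Summits.ResolutionOfSingularities.ResolutionOfSingularities.Theorems.HomologicalConductorNoZenoMinResolutionExists
import HarnessLib

/-!
# Crux `NoZenoR` (stmt-ResolutionOfSingularities-19943) — G0a / G0b / GE of the W4.4 chain MODULO statement B), BINDER-FREE
# (via `Lipman1969_1_2_of_B`; supersedes the `EssFiniteType k R`-binder versions of `…RationalAscentTowerOfB`)

Route `ResolutionOfSingularities/HomologicalConductor` (cell decomp-res, hand leafhand-res-homologicalconduct-12 g1).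
OURS: AI-written bookkeeping, weaker than expert review; nothing here is a statement of the manuscript under review
(Hironaka 2017).  SUPPORT level (`--supports stmt-19943`), counted 0.  Def-free.  One-liners: the three G-layer theorems of
`…NoZenoStageRational` / `…NoZenoMinResolutionExists` with `(h12 : Lipman1969_1_2) := Lipman1969_1_2_of_B hB`.

* `hasRationalSingularity_tower_of_B'` (G0a), `hasTrivialCechH1_of_isResolution_tower_of_B'` (G0b),
  `stub_minResolutionExists_of_B` (GE = registered stub `stub_minResolutionExists` with its `Lipman1969_1_2` binder replaced by
  `Lipman1969_1_2_B`; still modulo `Lipman1969_4_1`).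

No crux, kill test or summit statement is proved; resolution of singularities in positive characteristic is NOT proved.
-/

-- single-problem summit: the doubled namespace component `ResolutionOfSingularities` is forced
set_option linter.dupNamespace false

noncomputable section

namespace Summit.ResolutionOfSingularities.ResolutionOfSingularities.Theorems.NoZeno.RationalAscent

open CategoryTheory AlgebraicGeometry
open Literature.AlgebraicGeometry.Resolution
open Summit.ResolutionOfSingularities.ResolutionOfSingularities.Theorems.NoZeno.Birth
open Summit.ResolutionOfSingularities.ResolutionOfSingularities.Theorems.NoZeno.SandwichCluster

variable {k K : Type} [Field k] [Field K] [Algebra k K]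

/-- **G0a mod B), binder-free**: the singular sandwiched stage `T_m` has a rational singularity.
[cite: Lipman1969, Proposition (1.2) 1) (p. 199), statement B) (p. 200)] -/
theorem hasRationalSingularity_tower_of_B' (hB : Lipman1969_1_2_B.{0}) (O : ValuationSubring K)
    (A R : Subalgebra k K) (m₀ : ℕ) (ctx : SandwichCtx O A R m₀) (m : ℕ) (hm : m₀ + 1 ≤ m)
    (hsing : ¬ IsRegularLocalRing ↥(tower O A m)) : HasRationalSingularity ↥(tower O A m) :=
  hasRationalSingularity_tower (Lipman1969_1_2_of_B hB) O A R m₀ ctx m hm hsing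

/-- **G0b mod B), binder-free**: every resolution of the singular late stage has `H¹(X, 𝒪_X) = 0`.
[cite: Lipman1969, Proposition (1.2) 2) (p. 199), statement B) (p. 200)] -/
theorem hasTrivialCechH1_of_isResolution_tower_of_B' (hB : Lipman1969_1_2_B.{0}) (O : ValuationSubring K)
    (A R : Subalgebra k K) (m₀ : ℕ) (ctx : SandwichCtx O A R m₀) (m : ℕ) (hm : m₀ + 1 ≤ m)
    (hsing : ¬ IsRegularLocalRing ↥(tower O A m)) {X : Scheme.{0}}
    (π : X ⟶ Spec (.of ↥(tower O A m))) (hπ : IsResolution π) : HasTrivialCechH1 π :=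
  hasTrivialCechH1_of_isResolution_tower (Lipman1969_1_2_of_B hB) O A R m₀ ctx m hm hsing π hπ

/-- **GE mod B) (and (4.1)), binder-free**: the registered stub `stub_minResolutionExists` with its `Lipman1969_1_2` binder
replaced by `Lipman1969_1_2_B`. [cite: Lipman1969, Theorem (4.1) (p. 204), statement B) (p. 200)] -/
theorem stub_minResolutionExists_of_B
    (_hCJS : Literature.AlgebraicGeometry.Resolution.CossartJannsenSaito2020General.{0})
    (hB : Literature.AlgebraicGeometry.Resolution.Lipman1969_1_2_B.{0})
    (h41 : Literature.AlgebraicGeometry.Resolution.Lipman1969_4_1.{0})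
    (p : ℕ) (hp : p.Prime) (k K : Type) [Field k] [CharP k p] [Field K] [Algebra k K]
    (O : ValuationSubring K) (A R : Subalgebra k K) (m₀ : ℕ) (ctx : SandwichCtx O A R m₀) (m : ℕ)
    (hm : m₀ + 1 ≤ m) (hsing : ¬ IsRegularLocalRing ↥(tower O A m)) :
    ∃ (X : AlgebraicGeometry.Scheme.{0}) (π : X ⟶ AlgebraicGeometry.Spec (CommRingCat.of ↥(tower O A m))),
      Literature.AlgebraicGeometry.Resolution.IsMinimalResolution π :=
  stub_minResolutionExists _hCJS (Lipman1969_1_2_of_B hB) h41 p hp k K O A R m₀ ctx m hm hsing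

end Summit.ResolutionOfSingularities.ResolutionOfSingularities.Theorems.NoZeno.RationalAscent

end
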